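import Summits.Ventures.Crystal3D.Bulk.LocalTwelve
import HarnessLib

/-!
# A first-shell obstruction to close packing: two contact neighbours at distance `5/3`

HONEST FRAMING. Part of the venture `Summits/Ventures/Crystal3D` (cell `pub-crystal3d`, phase 2).
This file proves an ELEMENTARY, fully kernel-checked local lemma about the phase-2 vocabulary of
`Bulk/LocalTwelve.lean`; it is not a crystallization theorem and claims nothing about contact
maximisers. It is the formal core of the cell's answer to the question "can the three non-Barlow
36-contact 13-sphere clusters sit in the interior of a larger cluster?" (HOME file
`step0/max13/cpshell/CPEXT-RESULT.md`): each of those clusters contains a sphere two of whose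
contact neighbours are at distance exactly `5/3` — the two ends of a chain of three face-sharing
regular tetrahedra through that sphere (a segment of the Boerdijk–Coxeter tetrahelix) — and the
theorem below says that such a sphere NEVER has a close-packed (cuboctahedral / anticuboctahedral)
first shell, in any packing whatsoever.

## Contents (namespace `Summit.Ventures.Crystal3D`)
* `sqNormInt_sub_mem_of_fccInt`, `sqNormInt_sub_mem_of_hcpInt` (`decide`): the squared distances
  between two minimal vectors of the integer models of the FCC / HCP kissing patterns lie in
  `{0, 2, 4, 6, 8}` resp. `{0, 18, 36, 48, 54, 66, 72}`; i.e. after scaling, two members of a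
  close-packed shell of a unit-diameter ball are at squared distance in `{1, 2, 3, 4}` (fcc) or
  `{1, 2, 8/3, 3, 11/3, 4}` (hcp).
* `dist_sq_ne_of_mem_fccKissingPattern`, `dist_sq_ne_of_mem_hcpKissingPattern`: hence never
  `25/9` and never `34/9`.
* `not_isClosePackedShell_of_neighbour_dist_sq` (**the obstruction**): if two contact neighbours
  `j, k` of ball `i` satisfy `dist (x j) (x k) ^ 2 = 25/9` or `= 34/9`, then
  `¬ IsClosePackedShell x i`; `mem_nonClosePacked_of_neighbour_dist_sq`: `i ∈ nonClosePacked x`.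

## Why `25/9` and `34/9`
Three regular unit tetrahedra `T₁, T₂, T₃` with `T₁ ∩ T₂` and `T₂ ∩ T₃` common faces have their two
end vertices at distance `5/3` (bipyramid apices: squared distance `8/3`; one more reflection in a
face: `25/9`); both ends touch the two vertices of the common edge of the three tetrahedra. The
value `34/9` is the second exceptional separation found, by exact arithmetic in `ℚ(√2, √3)`, among
contact-neighbour pairs of the maximum-degree sphere of the three non-Barlow putative maximisers
`n13g1, n13g4, n13g6` of Holmes-Cerfon's enumeration (SIAM Rev. 58 (2016), ground states `n = 13`);
the exact coordinates and the census are cell data, not used here.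

## Design notes
* Everything is reduced to the integer models `fccInt`, `hcpInt` of
  `Literature/Geometry/DiscreteGeometry/KissingPatterns.lean` and `decide`.
* Only `j, k ∈ contactNeighbors x i` is used — no packing hypothesis is needed.
-/

noncomputable section

open Finset

namespace Summit.Ventures.Crystal3D

open Literature.Geometry.DiscreteGeometry (fccKissingPattern hcpKissingPattern IsArrangedIn
  intVec sqNormInt scaledPattern fccInt hcpInt norm_intVec intVec_sub)

variable {N : ℕ}

/-! ## Integer distance sets of the two patterns -/

/-- Squared distances between minimal vectors of `D₃` (the FCC integer model) lie in
`{0, 2, 4, 6, 8}`. -/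
theorem sqNormInt_sub_mem_of_fccInt :
    ∀ v ∈ fccInt, ∀ w ∈ fccInt, sqNormInt (v - w) ∈ ({0, 2, 4, 6, 8} : Finset ℤ) := by
  decide

/-- Squared distances between vectors of the HCP integer model (scale `18`) lie in
`{0, 18, 36, 48, 54, 66, 72}`. -/
theorem sqNormInt_sub_mem_of_hcpInt :
    ∀ v ∈ hcpInt, ∀ w ∈ hcpInt, sqNormInt (v - w) ∈ ({0, 18, 36, 48, 54, 66, 72} : Finset ℤ) := by
  decide

/-- In a scaled integer pattern `{v/√M : v ∈ S}` the squared distance of two points is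
`|v - w|² / M` for some `v, w ∈ S`. -/
theorem dist_sq_of_mem_scaledPattern {S : Finset (Fin 3 → ℤ)} {M : ℕ} (hM : M ≠ 0)
    {p q : EuclideanSpace ℝ (Fin 3)} (hp : p ∈ scaledPattern S M) (hq : q ∈ scaledPattern S M) :
    ∃ v ∈ S, ∃ w ∈ S, dist p q ^ 2 = (sqNormInt (v - w) : ℝ) / M := by
  obtain ⟨v, hv, rfl⟩ := Finset.mem_image.1 hp
  obtain ⟨w, hw, rfl⟩ := Finset.mem_image.1 hq
  refine ⟨v, hv, w, hw, ?_⟩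
  have hpos : (0 : ℝ) < Real.sqrt M := by positivity
  have hMpos : (0 : ℝ) < (M : ℝ) := by positivity
  rw [dist_eq_norm, ← smul_sub, intVec_sub, norm_smul, norm_inv, Real.norm_of_nonneg hpos.le,
    norm_intVec, mul_pow, inv_pow, Real.sq_sqrt hMpos.le,
    Real.sq_sqrt (by exact_mod_cast (show 0 ≤ sqNormInt (v - w) by unfold sqNormInt; positivity))]
  rw [div_eq_inv_mul]

/-- Two points of the FCC kissing pattern are never at squared distance `25/9` or `34/9`. -/
theorem dist_sq_ne_of_mem_fccKissingPattern {p q : EuclideanSpace ℝ (Fin 3)}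
    (hp : p ∈ fccKissingPattern) (hq : q ∈ fccKissingPattern) :
    dist p q ^ 2 ≠ 25 / 9 ∧ dist p q ^ 2 ≠ 34 / 9 := by
  obtain ⟨v, hv, w, hw, h⟩ := dist_sq_of_mem_scaledPattern two_ne_zero hp hq
  have hmem := sqNormInt_sub_mem_of_fccInt v hv w hw
  simp only [Finset.mem_insert, Finset.mem_singleton] at hmem
  rw [h]
  rcases hmem with h' | h' | h' | h' | h' <;> rw [h'] <;> norm_num

/-- Two points of the HCP kissing pattern are never at squared distance `25/9` or `34/9`. -/
theorem dist_sq_ne_of_mem_hcpKissingPattern {p q : EuclideanSpace ℝ (Fin 3)}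
    (hp : p ∈ hcpKissingPattern) (hq : q ∈ hcpKissingPattern) :
    dist p q ^ 2 ≠ 25 / 9 ∧ dist p q ^ 2 ≠ 34 / 9 := by
  obtain ⟨v, hv, w, hw, h⟩ := dist_sq_of_mem_scaledPattern (by norm_num) hp hq
  have hmem := sqNormInt_sub_mem_of_hcpInt v hv w hw
  simp only [Finset.mem_insert, Finset.mem_singleton] at hmem
  rw [h]
  rcases hmem with h' | h' | h' | h' | h' | h' | h' <;> rw [h'] <;> norm_num

/-! ## The obstruction -/

variable {x : Fin N → EuclideanSpace ℝ (Fin 3)}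

/-- If the contact shell of `i` is arranged in a pattern `P`, any two contact neighbours `j, k` of
`i` are at the same distance as two points of `P`. -/
theorem exists_dist_eq_of_isArrangedIn {i j k : Fin N} {P : Finset (EuclideanSpace ℝ (Fin 3))}
    (h : IsArrangedIn (contactShell x i) P) (hj : j ∈ contactNeighbors x i)
    (hk : k ∈ contactNeighbors x i) : ∃ p ∈ P, ∃ q ∈ P, dist (x j) (x k) = dist p q := by
  obtain ⟨A, hA⟩ := h
  have hj' : (2 : ℝ) • (x j - x i) ∈ contactShell x i := mem_contactShell.2 ⟨j, hj, rfl⟩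
  have hk' : (2 : ℝ) • (x k - x i) ∈ contactShell x i := mem_contactShell.2 ⟨k, hk, rfl⟩
  rw [hA] at hj' hk'
  obtain ⟨p, hp, hpj⟩ := hj'
  obtain ⟨q, hq, hqk⟩ := hk'
  refine ⟨p, hp, q, hq, ?_⟩
  have h2 : dist ((2 : ℝ) • (x j - x i)) ((2 : ℝ) • (x k - x i)) = 2 * dist (x j) (x k) := by
    rw [dist_smul₀, Real.norm_of_nonneg zero_le_two, dist_eq_norm, dist_eq_norm, sub_sub_sub_cancel_right]
  have h2' : dist ((2 : ℝ) • A p) ((2 : ℝ) • A q) = 2 * dist p q := by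
    rw [dist_smul₀, Real.norm_of_nonneg zero_le_two, A.dist_map]
  have := h2.symm.trans (by rw [← hpj, ← hqk, h2'])
  linarith

/-- **The tetrahelix obstruction.** If two contact neighbours `j, k` of ball `i` are at squared
distance `25/9` (distance `5/3`: the two ends of a chain of three face-sharing regular tetrahedra
through `i`) or `34/9`, then the first shell of `i` is NOT close-packed — whatever else surrounds
`i`. -/
theorem not_isClosePackedShell_of_neighbour_dist_sq {i j k : Fin N}
    (hj : j ∈ contactNeighbors x i) (hk : k ∈ contactNeighbors x i)
    (hd : dist (x j) (x k) ^ 2 = 25 / 9 ∨ dist (x j) (x k) ^ 2 = 34 / 9) :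
    ¬ IsClosePackedShell x i := by
  rintro (h | h)
  · obtain ⟨p, hp, q, hq, hpq⟩ := exists_dist_eq_of_isArrangedIn h hj hk
    have := dist_sq_ne_of_mem_fccKissingPattern hp hq
    rw [hpq] at hd
    exact hd.elim this.1 this.2
  · obtain ⟨p, hp, q, hq, hpq⟩ := exists_dist_eq_of_isArrangedIn h hj hk
    have := dist_sq_ne_of_mem_hcpKissingPattern hp hq
    rw [hpq] at hd
    exact hd.elim this.1 this.2

/-- Hence such a ball is one of the `nonClosePacked` balls counted by `BulkCrystallization3D`. -/
theorem mem_nonClosePacked_of_neighbour_dist_sq {i j k : Fin N}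
    (hj : j ∈ contactNeighbors x i) (hk : k ∈ contactNeighbors x i)
    (hd : dist (x j) (x k) ^ 2 = 25 / 9 ∨ dist (x j) (x k) ^ 2 = 34 / 9) :
    i ∈ nonClosePacked x :=
  mem_nonClosePacked.2 (not_isClosePackedShell_of_neighbour_dist_sq hj hk hd)

end Summit.Ventures.Crystal3D

end
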